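import Summits.AtomisticToContinuum.BoseEinsteinCondensation.Theorems.BECThomsonPrincipleGDTransferSeededSpectralDefs
import Summits.AtomisticToContinuum.BoseEinsteinCondensation.Theorems.BECThomsonPrincipleGDTransferSeededInteractionLocality
import Summits.AtomisticToContinuum.BoseEinsteinCondensation.Theorems.BECThomsonPrincipleGDTransferSeededSectorBlockAlgebra

/-!
# Route `BECThomsonPrinciple`, crux `GDTransfer` (stmt-AtomisticToContinuum-9482), line `seeded-continuity`:
# registered sub-goal `pinchingBound` (spectral seed programme) — the sector-pinched interaction is
# `≤ 16 ∫V|Ψ|² + 64 ‖v‖₁N²/L³`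

Supports (does not close) stmt-AtomisticToContinuum-9482.  Proves the registered sub-goal
`pinchingBound : PinchingBound` of `BECThomsonPrincipleGDTransferSeededSpectralDefs.lean`: for a finite continuous
finite-range profile `v`, `L > 0` and a periodic trial state `Ψ` of `N = m + 1` bosons,
`D(Ψ) = Σ_n ∫_{cell^N} V |Ψ^{(n)}|² ≤ 16 ∫_{cell^N} V|Ψ|² + 64 ‖v‖₁ N²/L³`, `Ψ^{(n)} = Σ_{|S| = n} Q_S Ψ` the block of
`Ψ` in the sector `n̂₀ = n` (`sectorBlock (· = n)`), `V = Σ_{p<q} v^per(x_p − x_q)`.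

Proof (pair by pair, in real numbers; constants `9`, `24`).  Fix `p ≠ q`, `w = v^per(x_p − x_q)` (continuous, flat in
every slot `l ∉ {p, q}`), `μ_S = ∫|Q_SΨ|²`, `ν_S = ∫ w|Q_SΨ|²`, `κ = ‖v‖₁/L³`.  FLAT BLOCKS: a sum `Σ_{S∈𝒯} Q_SΨ` over sets
all containing a slot `k ∈ {p, q}` is flat in `x_k` (`Lnss.cellAvg_modeProj`, `Negative.cellAvg_update`), so Jensen in
that slot (`PlainInteraction.integral_pairWeight_norm_sq_flat`) and Pythagoras (`Lnss.integral_norm_sq_sum_modeProj`)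
give `∫ w|Σ_{𝒯} Q_SΨ|² = κ Σ_{𝒯} μ_S`.  DOUBLY-EXCITED BLOCKS are `w`-orthogonal: for `S ≠ T` both avoiding `p, q` a slot
`l ∈ S ∆ T` lies outside the pair, `w` is flat there and `P_l` is self-adjoint, fixes one side and kills the other
(`InteractionLocalityProof.form_modeProj_eq_zero_of_flat`), so `∫ w|Σ_{𝒯} Q_SΨ|² = Σ_{𝒯} ν_S` for avoiding `𝒯`.  Split
`Ψ^{(n)}` by `p ∈ S` / `p ∉ S ∋ q` / `p, q ∉ S`, use `|a+b+c|² ≤ 3(|a|²+|b|²+|c|²)`, sum over `n` (the sectors partition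
the index sets, `Σ_S μ_S = 1`) and bound `Σ_{p,q∉S} ν_S = ∫ w|D|²`, `D = Ψ − Σ_{p∈S} Q_SΨ − Σ_{p∉S∋q} Q_SΨ`
(`Lnss.sum_modeProj`), by `3(∫ w|Ψ|² + 2κ)`: per pair `Σ_n ∫ w|Ψ^{(n)}|² ≤ 9 ∫ w|Ψ|² + 24κ`, and there are `≤ N²` pairs;
back to `ℝ≥0∞` by `PlainInteraction.ofReal_integral_weight_norm_sq`.  All [folklore] (ReedSimonIV1978 §XIII.12,
IMS-type localisation; LSSY2005 App. A).
-/

noncomputable section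

open MeasureTheory Filter
open scoped ENNReal NNReal ComplexConjugate

namespace Summit.AtomisticToContinuum.BoseEinsteinCondensation.Cruxes.GDTransfer.Seeded

namespace PinchingBoundProof

open Literature.MathematicalPhysics.QuantumManyBody.BoseGas
open Summit.AtomisticToContinuum.BoseEinsteinCondensation.Theorems.GaussianDominationCan.Negative
open Summit.AtomisticToContinuum.BoseEinsteinCondensation.Cruxes.GDTransfer.DysonDressedWitness
open Lnss PlainInteraction InteractionLocalityProof
open ChordVariation (continuous_modeProj)

variable {N m : ℕ} {L : ℝ} {v : ℝ → ℝ≥0∞}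

/-- `‖a + b + c‖² ≤ 3(‖a‖² + ‖b‖² + ‖c‖²)` in a seminormed commutative group. [folklore] -/
theorem norm_add_three_sq_le_three_mul {E : Type*} [SeminormedAddCommGroup E] (a b c : E) :
    ‖a + b + c‖ ^ 2 ≤ 3 * (‖a‖ ^ 2 + ‖b‖ ^ 2 + ‖c‖ ^ 2) := by
  calc ‖a + b + c‖ ^ 2 ≤ (‖a‖ + ‖b‖ + ‖c‖) ^ 2 := pow_le_pow_left₀ (norm_nonneg _) norm_add₃_le 2
    _ ≤ 3 * (‖a‖ ^ 2 + ‖b‖ ^ 2 + ‖c‖ ^ 2) := by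
        nlinarith [sq_nonneg (‖a‖ - ‖b‖), sq_nonneg (‖a‖ - ‖c‖), sq_nonneg (‖b‖ - ‖c‖)]

/-- `‖a − (b + c)‖² ≤ 3(‖a‖² + ‖b‖² + ‖c‖²)` in a seminormed commutative group. [folklore] -/
theorem norm_sub_add_sq_le_three_mul {E : Type*} [SeminormedAddCommGroup E] (a b c : E) :
    ‖a - (b + c)‖ ^ 2 ≤ 3 * (‖a‖ ^ 2 + ‖b‖ ^ 2 + ‖c‖ ^ 2) := by
  have h := norm_add_three_sq_le_three_mul a (-b) (-c)
  rwa [norm_neg, norm_neg, ← sub_eq_add_neg, ← sub_eq_add_neg, sub_sub] at h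

/-- Integrating a pointwise bound `|F|² ≤ 3(|f|² + |g|² + |h|²)` against a continuous weight `w ≥ 0` over the
cell (continuous entries). [folklore] -/
theorem integral_weight_norm_sq_le_three {w : Config N → ℝ} (hw : Continuous w) (hw0 : ∀ X, 0 ≤ w X)
    {F f g h : Config N → ℂ} (hF : Continuous F) (hf : Continuous f) (hg : Continuous g)
    (hh : Continuous h) (hle : ∀ X, ‖F X‖ ^ 2 ≤ 3 * (‖f X‖ ^ 2 + ‖g X‖ ^ 2 + ‖h X‖ ^ 2)) :
    ∫ X in cellN N L, w X * ‖F X‖ ^ 2 ≤ 3 * ((∫ X in cellN N L, w X * ‖f X‖ ^ 2) +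
      (∫ X in cellN N L, w X * ‖g X‖ ^ 2) + ∫ X in cellN N L, w X * ‖h X‖ ^ 2) := by
  have hi : ∀ {u : Config N → ℂ}, Continuous u →
      Integrable (fun X => w X * ‖u X‖ ^ 2) ((volume : Measure (Config N)).restrict (cellN N L)) :=
    fun hu => integrableOn_cellN (hw.mul (hu.norm.pow 2)) L
  have h2 : Integrable (fun X => w X * ‖f X‖ ^ 2 + w X * ‖g X‖ ^ 2) (volume.restrict (cellN N L)) :=
    (hi hf).add (hi hg)
  rw [← integral_add (hi hf) (hi hg), ← integral_add h2 (hi hh), ← integral_const_mul]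
  refine integral_mono (hi hF) ((h2.add (hi hh)).const_mul 3) fun X => ?_
  show w X * ‖F X‖ ^ 2 ≤ 3 * (w X * ‖f X‖ ^ 2 + w X * ‖g X‖ ^ 2 + w X * ‖h X‖ ^ 2)
  have hX := mul_le_mul_of_nonneg_left (hle X) (hw0 X)
  linarith

/-- Splitting a family of index sets by `p ∈ S` / `p ∉ S ∋ q` / `p, q ∉ S`. [folklore] -/
theorem sum_split_three {α : Type*} [AddCommMonoid α] (𝒯 : Finset (Finset (Fin N))) (p q : Fin N)
    (f : Finset (Fin N) → α) :
    ∑ S ∈ 𝒯, f S = ∑ S ∈ 𝒯.filter (fun S => p ∈ S), f S +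
      ∑ S ∈ 𝒯.filter (fun S => p ∉ S ∧ q ∈ S), f S + ∑ S ∈ 𝒯.filter (fun S => p ∉ S ∧ q ∉ S), f S := by
  rw [← Finset.sum_filter_add_sum_filter_not 𝒯 (fun S => p ∈ S) f, add_assoc,
    ← Finset.sum_filter_add_sum_filter_not (𝒯.filter fun S => p ∉ S) (fun S => q ∈ S) f,
    Finset.filter_filter, Finset.filter_filter]

/-- The sectors `|S| = n`, `n < m + 2`, partition every family of index sets. [folklore] -/
theorem sum_range_sum_filter_card (P : Finset (Fin (m + 1)) → Prop) [DecidablePred P]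
    (f : Finset (Fin (m + 1)) → ℝ) :
    ∑ n ∈ Finset.range (m + 2),
        ∑ S ∈ ((Finset.univ : Finset (Finset (Fin (m + 1)))).filter fun S => S.card = n).filter P, f S =
      ∑ S ∈ (Finset.univ : Finset (Finset (Fin (m + 1)))).filter P, f S := by
  have hmaps : ∀ S ∈ (Finset.univ : Finset (Finset (Fin (m + 1)))).filter P,
      S.card ∈ Finset.range (m + 2) := fun S _ =>
    Finset.mem_range.2 (by have h := S.card_le_univ; rw [Fintype.card_fin] at h; omega)
  rw [← Finset.sum_fiberwise_of_maps_to hmaps f]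
  exact Finset.sum_congr rfl fun n _ => by rw [Finset.filter_comm]

/-! ## The `Q_S`-calculus against a weight flat outside the pair -/

/-- For `k ∈ S` and continuous `g`, `Q_S g = P_k Q_S g` does not depend on `x_k`. [folklore] -/
theorem modeProj_update_of_mem (hL : 0 < L) {S : Finset (Fin N)} {k : Fin N} (hk : k ∈ S)
    {g : Config N → ℂ} (hg : Continuous g) (X : Config N) (z : Space) :
    modeProj N L S g (Function.update X k z) = modeProj N L S g X := by
  have h := cellAvg_modeProj hL S k hg
  rw [if_pos hk] at h
  rw [← h]
  exact cellAvg_update k _ X z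

section Pair

variable {w : Config (m + 1) → ℝ} {p q : Fin (m + 1)} {κ : ℝ} {ψ : Config (m + 1) → ℂ} (hL : 0 < L)
  (hψ : Continuous ψ)

include hL hψ in
/-- `Σ_{S∈𝒯} ∫|Q_Sψ|² ≤ ∫|ψ|²` (Pythagoras and `Σ_S Q_S = 1`, `Lnss.sum_integral_norm_sq_modeProj`). [folklore] -/
theorem sum_integral_norm_sq_modeProj_le (𝒯 : Finset (Finset (Fin (m + 1)))) :
    ∑ S ∈ 𝒯, ∫ X in cellN (m + 1) L, ‖modeProj (m + 1) L S ψ X‖ ^ 2 ≤ ∫ X in cellN (m + 1) L, ‖ψ X‖ ^ 2 := by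
  rw [← sum_integral_norm_sq_modeProj hL hψ]
  exact Finset.sum_le_univ_sum_of_nonneg fun S => integral_nonneg fun X => sq_nonneg _

-- JENSEN IN A SLOT OF THE PAIR: `∫ w|h|² = κ ∫|h|²` for continuous `h` flat in `x_p` or in `x_q` (for
-- `w = v^per(x_p − x_q)`, `κ = ‖v‖₁/L³` this is `PlainInteraction.integral_pairWeight_norm_sq_flat`)
variable (hJ : ∀ k, (k = p ∨ k = q) → ∀ h : Config (m + 1) → ℂ, Continuous h →
  (∀ X z, h (Function.update X k z) = h X) →
  ∫ X in cellN (m + 1) L, w X * ‖h X‖ ^ 2 = κ * ∫ X in cellN (m + 1) L, ‖h X‖ ^ 2)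

include hL hψ hJ in
/-- **A block with a flat particle of the pair**: if every `S ∈ 𝒯` contains the slot `k ∈ {p, q}`, then
`Σ_{S∈𝒯} Q_Sψ` does not depend on `x_k`, so Jensen in the slot and Pythagoras give
`∫ w|Σ_{𝒯} Q_Sψ|² = κ Σ_{𝒯} ∫|Q_Sψ|²`. [folklore] -/
theorem integral_weight_block_flat {k : Fin (m + 1)} (hk : k = p ∨ k = q) (𝒯 : Finset (Finset (Fin (m + 1))))
    (h𝒯 : ∀ S ∈ 𝒯, k ∈ S) :
    ∫ X in cellN (m + 1) L, w X * ‖∑ S ∈ 𝒯, modeProj (m + 1) L S ψ X‖ ^ 2 =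
      κ * ∑ S ∈ 𝒯, ∫ X in cellN (m + 1) L, ‖modeProj (m + 1) L S ψ X‖ ^ 2 := by
  have hP := integral_norm_sq_sum_modeProj hL 𝒯 (fun _ => (1 : ℂ)) hψ
  simp only [one_mul, norm_one, one_pow] at hP
  rw [← hP]
  exact hJ k hk (fun X => ∑ S ∈ 𝒯, modeProj (m + 1) L S ψ X)
    (continuous_finsetSum _ fun S _ => continuous_modeProj S hψ)
    fun X z => Finset.sum_congr rfl fun S hS => modeProj_update_of_mem hL (h𝒯 S hS) hψ X z

variable (hw : Continuous w) (hwflat : ∀ l, p ≠ l → q ≠ l → ∀ X z, w (Function.update X l z) = w X)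

include hL hψ hw hwflat in
/-- **Doubly-excited components are `w`-orthogonal**: for a continuous real weight `w` flat in every slot outside
`{p, q}` and `S ≠ T` both avoiding `p` and `q`, `∫ w conj(Q_Sψ) Q_Tψ = 0` — a slot `l ∈ S ∆ T` lies outside the pair
and `P_l` is self-adjoint, commutes with `w`, fixes one side and kills the other (`form_modeProj_eq_zero_of_flat`).
[folklore] -/
theorem form_modeProj_avoid_eq_zero {S T : Finset (Fin (m + 1))} (hST : S ≠ T) (hpS : p ∉ S) (hqS : q ∉ S)
    (hpT : p ∉ T) (hqT : q ∉ T) :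
    ∫ X in cellN (m + 1) L, ((w X : ℝ) : ℂ) *
        (conj (modeProj (m + 1) L S ψ X) * modeProj (m + 1) L T ψ X) = 0 := by
  obtain ⟨l, hl⟩ : ∃ l, ¬(l ∈ S ↔ l ∈ T) := not_forall.1 fun h => hST (Finset.ext h)
  by_cases hlT : l ∈ T
  · have hlS : l ∉ S := fun h => hl (iff_of_true h hlT)
    exact form_modeProj_eq_zero_of_flat hL hlT hlS hw
      (hwflat l (fun h => hpT (h ▸ hlT)) (fun h => hqT (h ▸ hlT))) hψ hψ
  · have hlS : l ∈ S := of_not_not fun h => hl (iff_of_false h hlT)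
    rw [form_conj_symm w (modeProj (m + 1) L T ψ) (modeProj (m + 1) L S ψ),
      form_modeProj_eq_zero_of_flat hL hlS hlT hw
        (hwflat l (fun h => hpS (h ▸ hlS)) (fun h => hqS (h ▸ hlS))) hψ hψ, map_zero]

include hL hψ hw hwflat in
/-- **Weighted Pythagoras on an avoiding family**: if every `S ∈ 𝒯` avoids `p` and `q`, then
`∫ w|Σ_{S∈𝒯} Q_Sψ|² = Σ_{S∈𝒯} ∫ w|Q_Sψ|²`. [folklore] -/
theorem integral_weight_norm_sq_sum_avoid (𝒯 : Finset (Finset (Fin (m + 1))))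
    (h𝒯 : ∀ S ∈ 𝒯, p ∉ S ∧ q ∉ S) :
    ∫ X in cellN (m + 1) L, w X * ‖∑ S ∈ 𝒯, modeProj (m + 1) L S ψ X‖ ^ 2 =
      ∑ S ∈ 𝒯, ∫ X in cellN (m + 1) L, w X * ‖modeProj (m + 1) L S ψ X‖ ^ 2 := by
  have hQ : ∀ S, Continuous (modeProj (m + 1) L S ψ) := fun S => continuous_modeProj S hψ
  have hF : Continuous fun X => ∑ S ∈ 𝒯, modeProj (m + 1) L S ψ X :=
    continuous_finsetSum _ fun S _ => hQ S
  apply Complex.ofReal_injective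
  calc ((∫ X in cellN (m + 1) L, w X * ‖∑ S ∈ 𝒯, modeProj (m + 1) L S ψ X‖ ^ 2 : ℝ) : ℂ)
      = ∫ X in cellN (m + 1) L, ((w X : ℝ) : ℂ) *
          (conj (∑ S ∈ 𝒯, modeProj (m + 1) L S ψ X) * ∑ T ∈ 𝒯, modeProj (m + 1) L T ψ X) :=
        (form_self w _).symm
    _ = ∑ S ∈ 𝒯, ∑ T ∈ 𝒯, ∫ X in cellN (m + 1) L, ((w X : ℝ) : ℂ) *
          (conj (modeProj (m + 1) L S ψ X) * modeProj (m + 1) L T ψ X) := by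
        rw [form_sum_left 𝒯 hw (fun S _ => hQ S) hF]
        exact Finset.sum_congr rfl fun S _ => form_sum_right 𝒯 hw (hQ S) fun T _ => hQ T
    _ = ∑ S ∈ 𝒯, ((∫ X in cellN (m + 1) L, w X * ‖modeProj (m + 1) L S ψ X‖ ^ 2 : ℝ) : ℂ) := by
        refine Finset.sum_congr rfl fun S hS => ?_
        rw [Finset.sum_eq_single_of_mem S hS fun T hT hTS =>
          form_modeProj_avoid_eq_zero hL hψ hw hwflat (Ne.symm hTS) (h𝒯 S hS).1 (h𝒯 S hS).2 (h𝒯 T hT).1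
            (h𝒯 T hT).2]
        exact form_self w _
    _ = ((∑ S ∈ 𝒯, ∫ X in cellN (m + 1) L, w X * ‖modeProj (m + 1) L S ψ X‖ ^ 2 : ℝ) : ℂ) :=
        (Complex.ofReal_sum _ _).symm

variable (hw0 : ∀ X, 0 ≤ w X)

include hL hψ hJ hw hwflat hw0

/-- **One block, one pair.**  Splitting `Σ_{S∈𝒯} Q_Sψ` by `p ∈ S` (flat in `x_p`), `p ∉ S ∋ q` (flat in `x_q`) and
`p, q ∉ S` (doubly excited, `w`-orthogonal): `∫ w|Σ_{𝒯} Q_Sψ|² ≤ 3(κ Σ_{𝒯, p∈S} μ_S + κ Σ_{𝒯, p∉S∋q} μ_S +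
Σ_{𝒯, p,q∉S} ν_S)`, `μ_S = ∫|Q_Sψ|²`, `ν_S = ∫ w|Q_Sψ|²`. [folklore] -/
theorem integral_weight_block_le (𝒯 : Finset (Finset (Fin (m + 1)))) :
    ∫ X in cellN (m + 1) L, w X * ‖∑ S ∈ 𝒯, modeProj (m + 1) L S ψ X‖ ^ 2 ≤
      3 * (κ * (∑ S ∈ 𝒯.filter (fun S => p ∈ S), ∫ X in cellN (m + 1) L, ‖modeProj (m + 1) L S ψ X‖ ^ 2) +
        κ * (∑ S ∈ 𝒯.filter (fun S => p ∉ S ∧ q ∈ S),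
          ∫ X in cellN (m + 1) L, ‖modeProj (m + 1) L S ψ X‖ ^ 2) +
        ∑ S ∈ 𝒯.filter (fun S => p ∉ S ∧ q ∉ S),
          ∫ X in cellN (m + 1) L, w X * ‖modeProj (m + 1) L S ψ X‖ ^ 2) := by
  have hsum : ∀ 𝒰 : Finset (Finset (Fin (m + 1))),
      Continuous fun X => ∑ S ∈ 𝒰, modeProj (m + 1) L S ψ X :=
    fun 𝒰 => continuous_finsetSum _ fun S _ => continuous_modeProj S hψ
  rw [← integral_weight_block_flat hL hψ hJ (Or.inl rfl) (𝒯.filter fun S => p ∈ S)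
      (fun S hS => (Finset.mem_filter.1 hS).2),
    ← integral_weight_block_flat hL hψ hJ (Or.inr rfl) (𝒯.filter fun S => p ∉ S ∧ q ∈ S)
      (fun S hS => (Finset.mem_filter.1 hS).2.2),
    ← integral_weight_norm_sq_sum_avoid hL hψ hw hwflat (𝒯.filter fun S => p ∉ S ∧ q ∉ S)
      (fun S hS => (Finset.mem_filter.1 hS).2)]
  exact integral_weight_norm_sq_le_three hw hw0 (hsum 𝒯) (hsum _) (hsum _) (hsum _) fun X => by
    rw [sum_split_three 𝒯 p q (fun S => modeProj (m + 1) L S ψ X)]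
    exact norm_add_three_sq_le_three_mul _ _ _

/-- **The doubly-excited block of the whole state**: `D = Σ_{p,q∉S} Q_Sψ = ψ − Σ_{p∈S} Q_Sψ − Σ_{p∉S∋q} Q_Sψ`
(`Σ_S Q_S = 1`), so `Σ_{p,q∉S} ν_S = ∫ w|D|² ≤ 3(∫ w|ψ|² + κ Σ_{p∈S} μ_S + κ Σ_{p∉S∋q} μ_S)`. [folklore] -/
theorem sum_avoid_le :
    ∑ S ∈ (Finset.univ : Finset (Finset (Fin (m + 1)))).filter (fun S => p ∉ S ∧ q ∉ S),
        ∫ X in cellN (m + 1) L, w X * ‖modeProj (m + 1) L S ψ X‖ ^ 2 ≤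
      3 * ((∫ X in cellN (m + 1) L, w X * ‖ψ X‖ ^ 2) +
        κ * (∑ S ∈ (Finset.univ : Finset (Finset (Fin (m + 1)))).filter (fun S => p ∈ S),
          ∫ X in cellN (m + 1) L, ‖modeProj (m + 1) L S ψ X‖ ^ 2) +
        κ * ∑ S ∈ (Finset.univ : Finset (Finset (Fin (m + 1)))).filter (fun S => p ∉ S ∧ q ∈ S),
          ∫ X in cellN (m + 1) L, ‖modeProj (m + 1) L S ψ X‖ ^ 2) := by
  have hsum : ∀ 𝒰 : Finset (Finset (Fin (m + 1))),
      Continuous fun X => ∑ S ∈ 𝒰, modeProj (m + 1) L S ψ X :=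
    fun 𝒰 => continuous_finsetSum _ fun S _ => continuous_modeProj S hψ
  rw [← integral_weight_norm_sq_sum_avoid hL hψ hw hwflat _ (fun S hS => (Finset.mem_filter.1 hS).2),
    ← integral_weight_block_flat hL hψ hJ (Or.inl rfl)
      ((Finset.univ : Finset (Finset (Fin (m + 1)))).filter fun S => p ∈ S)
      (fun S hS => (Finset.mem_filter.1 hS).2),
    ← integral_weight_block_flat hL hψ hJ (Or.inr rfl)
      ((Finset.univ : Finset (Finset (Fin (m + 1)))).filter fun S => p ∉ S ∧ q ∈ S)
      (fun S hS => (Finset.mem_filter.1 hS).2.2)]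
  refine integral_weight_norm_sq_le_three hw hw0 (hsum _) hψ (hsum _) (hsum _) fun X => ?_
  have hid : ∑ S : Finset (Fin (m + 1)), modeProj (m + 1) L S ψ X = ψ X := by
    have h := congrFun (sum_modeProj (L := L) ψ) X
    rwa [Finset.sum_apply] at h
  rw [sum_split_three Finset.univ p q (fun S => modeProj (m + 1) L S ψ X)] at hid
  rw [eq_sub_of_add_eq' hid]
  exact norm_sub_add_sq_le_three_mul _ _ _

/-- **One pair, all sectors**: `Σ_{n ≤ N} ∫ w|Ψ^{(n)}|² ≤ 9 ∫ w|ψ|² + 24 κ ∫|ψ|²` (`κ ≥ 0`) — the one-block bound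
summed over the sectors `|S| = n` (which partition the index sets), plus the bound for the doubly-excited block.
[folklore] -/
theorem sum_sectorBlock_le (hκ : 0 ≤ κ) :
    ∑ n ∈ Finset.range (m + 2), ∫ X in cellN (m + 1) L, w X * ‖sectorBlock m L (fun i => i = n) ψ X‖ ^ 2 ≤
      9 * (∫ X in cellN (m + 1) L, w X * ‖ψ X‖ ^ 2) + 24 * κ * ∫ X in cellN (m + 1) L, ‖ψ X‖ ^ 2 := by
  have h1 := sum_integral_norm_sq_modeProj_le hL hψ
    ((Finset.univ : Finset (Finset (Fin (m + 1)))).filter fun S => p ∈ S)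
  have h2 := sum_integral_norm_sq_modeProj_le hL hψ
    ((Finset.univ : Finset (Finset (Fin (m + 1)))).filter fun S => p ∉ S ∧ q ∈ S)
  have h3 := sum_avoid_le hL hψ hJ hw hwflat hw0
  calc ∑ n ∈ Finset.range (m + 2), ∫ X in cellN (m + 1) L, w X * ‖sectorBlock m L (fun i => i = n) ψ X‖ ^ 2
      = ∑ n ∈ Finset.range (m + 2), ∫ X in cellN (m + 1) L, w X *
          ‖∑ S ∈ (Finset.univ : Finset (Finset (Fin (m + 1)))).filter (fun S => S.card = n),
            modeProj (m + 1) L S ψ X‖ ^ 2 := by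
        simp only [SectorBlock.sectorBlock_apply]
    _ ≤ 3 * (κ * (∑ S ∈ (Finset.univ : Finset (Finset (Fin (m + 1)))).filter (fun S => p ∈ S),
            ∫ X in cellN (m + 1) L, ‖modeProj (m + 1) L S ψ X‖ ^ 2) +
          κ * (∑ S ∈ (Finset.univ : Finset (Finset (Fin (m + 1)))).filter (fun S => p ∉ S ∧ q ∈ S),
            ∫ X in cellN (m + 1) L, ‖modeProj (m + 1) L S ψ X‖ ^ 2) +
          ∑ S ∈ (Finset.univ : Finset (Finset (Fin (m + 1)))).filter (fun S => p ∉ S ∧ q ∉ S),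
            ∫ X in cellN (m + 1) L, w X * ‖modeProj (m + 1) L S ψ X‖ ^ 2) := by
        refine (Finset.sum_le_sum fun n _ => integral_weight_block_le hL hψ hJ hw hwflat hw0
          ((Finset.univ : Finset (Finset (Fin (m + 1)))).filter fun S => S.card = n)).trans_eq ?_
        rw [← Finset.mul_sum, Finset.sum_add_distrib, Finset.sum_add_distrib, ← Finset.mul_sum,
          ← Finset.mul_sum, sum_range_sum_filter_card, sum_range_sum_filter_card, sum_range_sum_filter_card]
    _ ≤ 9 * (∫ X in cellN (m + 1) L, w X * ‖ψ X‖ ^ 2) + 24 * κ * ∫ X in cellN (m + 1) L, ‖ψ X‖ ^ 2 := by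
        nlinarith [mul_le_mul_of_nonneg_left h1 hκ, mul_le_mul_of_nonneg_left h2 hκ, h3]

end Pair

/-! ## The interaction as a sum of pair weights; `ℝ≥0∞` dictionary -/

/-- `∫⁻ V‖f‖₊² = ofReal (∫ V|f|²)` over the cell for continuous `f` and a finite continuous finite-range profile
(its periodic interaction is finite and continuous). [folklore] -/
theorem lintegral_interaction_nnnorm_sq (hv : IsRepulsiveFiniteRange v) (hfc : IsFiniteContinuous v)
    (hL : L ≠ 0) {f : Config N → ℂ} (hf : Continuous f) :
    ∫⁻ X in cellN N L, periodicInteraction v L X * (‖f X‖₊ : ℝ≥0∞) ^ 2 =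
      ENNReal.ofReal (∫ X in cellN N L, (periodicInteraction v L X).toReal * ‖f X‖ ^ 2) := by
  rw [ofReal_integral_weight_norm_sq (continuous_toReal_periodicInteraction (N := N) hv hfc hL)
    (fun X => ENNReal.toReal_nonneg) hf]
  have hne : ∀ X : Config N, periodicInteraction v L X ≠ ⊤ := fun X =>
    ENNReal.sum_ne_top.2 fun _ _ => ENNReal.sum_ne_top.2 fun _ _ => periodizedPotential_ne_top hv hfc hL _
  exact lintegral_congr fun X => by rw [ENNReal.ofReal_toReal (hne X)]

/-- `∫ V|f|² = Σ_p Σ_{q>p} ∫ v^per(x_p − x_q)|f|²` for continuous `f` (finite continuous profile). [folklore] -/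
theorem integral_interaction_norm_sq_eq_sum (hv : IsRepulsiveFiniteRange v) (hfc : IsFiniteContinuous v)
    (hL : L ≠ 0) {f : Config N → ℂ} (hf : Continuous f) :
    ∫ X in cellN N L, (periodicInteraction v L X).toReal * ‖f X‖ ^ 2 =
      ∑ p : Fin N, ∑ q ∈ (Finset.univ : Finset (Fin N)).filter (fun q => p < q),
        ∫ X in cellN N L, (periodizedPotential v L (X p - X q)).toReal * ‖f X‖ ^ 2 := by
  have hI : ∀ p q : Fin N, Integrable (fun X => (periodizedPotential v L (X p - X q)).toReal * ‖f X‖ ^ 2)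
      ((volume : Measure (Config N)).restrict (cellN N L)) := fun p q =>
    integrableOn_cellN ((continuous_pairWeight hv hfc hL p q).mul (hf.norm.pow 2)) L
  calc ∫ X in cellN N L, (periodicInteraction v L X).toReal * ‖f X‖ ^ 2
      = ∫ X in cellN N L, ∑ p : Fin N, ∑ q ∈ (Finset.univ : Finset (Fin N)).filter (fun q => p < q),
          (periodizedPotential v L (X p - X q)).toReal * ‖f X‖ ^ 2 := by
        refine integral_congr_ae (Eventually.of_forall fun X => ?_)
        simp only [toReal_periodicInteraction hv hfc hL, Finset.sum_mul]
    _ = ∑ p : Fin N, ∑ q ∈ (Finset.univ : Finset (Fin N)).filter (fun q => p < q),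
          ∫ X in cellN N L, (periodizedPotential v L (X p - X q)).toReal * ‖f X‖ ^ 2 := by
        rw [integral_finsetSum _ fun p _ => integrable_finsetSum _ fun q _ => hI p q]
        exact Finset.sum_congr rfl fun p _ => integral_finsetSum _ fun q _ => hI p q

end PinchingBoundProof

open Literature.MathematicalPhysics.QuantumManyBody.BoseGas PlainInteraction PinchingBoundProof

/-- **THE PINCHING BOUND** (registered sub-goal `pinchingBound` of the spectral seed programme, line
`seeded-continuity`): for a finite continuous finite-range profile `v`, `L > 0` and a periodic trial state `Ψ` of
`N = m + 1` bosons, `Σ_n ∫ V|Ψ^{(n)}|² ≤ 16 ∫ V|Ψ|² + 64 ‖v‖₁ N²/L³` — pair by pair, blocks with a cell-averaged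
particle of the pair are worth `‖v‖₁/L³` per unit mass (Jensen in the flat slot) and the doubly-excited blocks are
`v^per(x_p − x_q)`-orthogonal across the sectors (a slot of the other particles separates them); the proof gives the
constants `9` and `24`. [folklore] (ReedSimonIV1978 §XIII.12; LSSY2005 App. A) -/
theorem pinchingBound : PinchingBound := by
  intro v hv hfc m L hL Ψ
  have hψ : Continuous Ψ.ψ := Ψ.contDiff.continuous
  have hM : ∫ X in cellN (m + 1) L, ‖Ψ.ψ X‖ ^ 2 = 1 := integral_norm_sq_trialState Ψ
  have hκ0 : 0 ≤ ((ENNReal.ofReal (L ^ 3))⁻¹ * ∫⁻ x : Space, v ‖x‖).toReal := ENNReal.toReal_nonneg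
  have h64 : 64 * lift1 v * ((m : ℝ) + 1) ^ 2 / L ^ 3 =
      64 * (((ENNReal.ofReal (L ^ 3))⁻¹ * ∫⁻ x : Space, v ‖x‖).toReal * ((m : ℝ) + 1) ^ 2) := by
    rw [lift1, ENNReal.toReal_mul, ENNReal.toReal_inv, ENNReal.toReal_ofReal (pow_nonneg hL.le 3)]; ring
  -- one pair, all sectors (real form, `∫|Ψ|² = 1`)
  have hpair : ∀ p q : Fin (m + 1), p ≠ q →
      ∑ n ∈ Finset.range (m + 2), ∫ X in cellN (m + 1) L, (periodizedPotential v L (X p - X q)).toReal *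
          ‖sectorBlock m L (fun i => i = n) Ψ.ψ X‖ ^ 2 ≤
        9 * (∫ X in cellN (m + 1) L, (periodizedPotential v L (X p - X q)).toReal * ‖Ψ.ψ X‖ ^ 2) +
          24 * ((ENNReal.ofReal (L ^ 3))⁻¹ * ∫⁻ x : Space, v ‖x‖).toReal := by
    intro p q hpq
    have h := sum_sectorBlock_le hL hψ
      (fun k hk h hh hflat => integral_pairWeight_norm_sq_flat hL hv hfc hpq hk hh hflat)
      (continuous_pairWeight hv hfc hL.ne' p q) (fun l hpl hql X z => pairWeight_update v L hpl hql X z)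
      (fun X => ENNReal.toReal_nonneg) hκ0
    rwa [hM, mul_one] at h
  -- all pairs
  have hreal : ∑ n ∈ Finset.range (m + 2), ∫ X in cellN (m + 1) L,
        (periodicInteraction v L X).toReal * ‖sectorBlock m L (fun i => i = n) Ψ.ψ X‖ ^ 2 ≤
      9 * (∫ X in cellN (m + 1) L, (periodicInteraction v L X).toReal * ‖Ψ.ψ X‖ ^ 2) +
        24 * ((ENNReal.ofReal (L ^ 3))⁻¹ * ∫⁻ x : Space, v ‖x‖).toReal * ((m : ℝ) + 1) ^ 2 := by
    calc ∑ n ∈ Finset.range (m + 2), ∫ X in cellN (m + 1) L,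
          (periodicInteraction v L X).toReal * ‖sectorBlock m L (fun i => i = n) Ψ.ψ X‖ ^ 2
        = ∑ p : Fin (m + 1), ∑ q ∈ (Finset.univ : Finset (Fin (m + 1))).filter (fun q => p < q),
            ∑ n ∈ Finset.range (m + 2), ∫ X in cellN (m + 1) L,
              (periodizedPotential v L (X p - X q)).toReal * ‖sectorBlock m L (fun i => i = n) Ψ.ψ X‖ ^ 2 :=
          (Finset.sum_congr rfl fun n _ => integral_interaction_norm_sq_eq_sum hv hfc hL.ne'
            (SectorBlock.continuous_sectorBlock (fun i => i = n) hψ)).trans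
            (Finset.sum_comm.trans (Finset.sum_congr rfl fun p _ => Finset.sum_comm))
      _ ≤ ∑ p : Fin (m + 1), ∑ q ∈ (Finset.univ : Finset (Fin (m + 1))).filter (fun q => p < q),
            (9 * (∫ X in cellN (m + 1) L, (periodizedPotential v L (X p - X q)).toReal * ‖Ψ.ψ X‖ ^ 2) +
              24 * ((ENNReal.ofReal (L ^ 3))⁻¹ * ∫⁻ x : Space, v ‖x‖).toReal) :=
          Finset.sum_le_sum fun p _ => Finset.sum_le_sum fun q hq =>
            hpair p q (ne_of_lt (Finset.mem_filter.1 hq).2)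
      _ = 9 * (∑ p : Fin (m + 1), ∑ q ∈ (Finset.univ : Finset (Fin (m + 1))).filter (fun q => p < q),
              ∫ X in cellN (m + 1) L, (periodizedPotential v L (X p - X q)).toReal * ‖Ψ.ψ X‖ ^ 2) +
            ∑ p : Fin (m + 1), ∑ q ∈ (Finset.univ : Finset (Fin (m + 1))).filter (fun q => p < q),
              24 * ((ENNReal.ofReal (L ^ 3))⁻¹ * ∫⁻ x : Space, v ‖x‖).toReal := by
          simp only [Finset.sum_add_distrib, Finset.mul_sum]
      _ ≤ 9 * (∫ X in cellN (m + 1) L, (periodicInteraction v L X).toReal * ‖Ψ.ψ X‖ ^ 2) +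
            24 * ((ENNReal.ofReal (L ^ 3))⁻¹ * ∫⁻ x : Space, v ‖x‖).toReal * ((m : ℝ) + 1) ^ 2 := by
          rw [← integral_interaction_norm_sq_eq_sum hv hfc hL.ne' hψ]
          refine add_le_add le_rfl ((Finset.sum_le_sum fun p _ => Finset.sum_le_univ_sum_of_nonneg
            fun _ => mul_nonneg (by norm_num) hκ0).trans (le_of_eq ?_))
          simp only [Finset.sum_const, Finset.card_univ, Fintype.card_fin, nsmul_eq_mul]
          push_cast
          ring
  -- back to `ℝ≥0∞`
  have hnn : ∀ f : Config (m + 1) → ℂ,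
      0 ≤ ∫ X in cellN (m + 1) L, (periodicInteraction v L X).toReal * ‖f X‖ ^ 2 :=
    fun f => integral_nonneg fun X => mul_nonneg ENNReal.toReal_nonneg (sq_nonneg _)
  have hC0 : 0 ≤ 64 * lift1 v * ((m : ℝ) + 1) ^ 2 / L ^ 3 := by rw [h64]; positivity
  have hLHS : sectorDiagV v m L Ψ.ψ = ENNReal.ofReal (∑ n ∈ Finset.range (m + 2), ∫ X in cellN (m + 1) L,
      (periodicInteraction v L X).toReal * ‖sectorBlock m L (fun i => i = n) Ψ.ψ X‖ ^ 2) := by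
    rw [sectorDiagV, ENNReal.ofReal_sum_of_nonneg fun n _ => hnn _]
    exact Finset.sum_congr rfl fun n _ =>
      lintegral_interaction_nnnorm_sq hv hfc hL.ne' (SectorBlock.continuous_sectorBlock _ hψ)
  rw [hLHS, lintegral_interaction_nnnorm_sq hv hfc hL.ne' hψ]
  calc ENNReal.ofReal (∑ n ∈ Finset.range (m + 2), ∫ X in cellN (m + 1) L,
        (periodicInteraction v L X).toReal * ‖sectorBlock m L (fun i => i = n) Ψ.ψ X‖ ^ 2)
      ≤ ENNReal.ofReal (16 * (∫ X in cellN (m + 1) L, (periodicInteraction v L X).toReal * ‖Ψ.ψ X‖ ^ 2) +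
          64 * lift1 v * ((m : ℝ) + 1) ^ 2 / L ^ 3) := by
        refine ENNReal.ofReal_le_ofReal (hreal.trans ?_)
        rw [h64]
        nlinarith [mul_nonneg hκ0 (sq_nonneg ((m : ℝ) + 1)), hnn Ψ.ψ]
    _ = 16 * ENNReal.ofReal (∫ X in cellN (m + 1) L, (periodicInteraction v L X).toReal * ‖Ψ.ψ X‖ ^ 2) +
          ENNReal.ofReal (64 * lift1 v * ((m : ℝ) + 1) ^ 2 / L ^ 3) := by
        rw [ENNReal.ofReal_add (mul_nonneg (by norm_num) (hnn _)) hC0, ENNReal.ofReal_mul (by norm_num),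
          ENNReal.ofReal_ofNat]

end Summit.AtomisticToContinuum.BoseEinsteinCondensation.Cruxes.GDTransfer.Seeded

end
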